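import Summits.AtomisticToContinuum.Crystallization.Theorems.HullExactificationCascadeExactHcpLocalTheoremLayers

/-!
# Route HullExactificationCascade — item `ExactHcpLocalTheorem` (G), helper 8: exactification

Helper file 8 for `stmt-AtomisticToContinuum-12093`.  **`η`-congruence for every `η > 0` is exact
congruence**: the punctured cluster `P` is finite, so one bijection `e : T ≃ P` serves every `η`
(pigeonhole, `exists_equiv_forall_eta`); then the Gram matrices agree (`inner_eq_of_forall_eta`,
error `≤ 2rη`); a Gram-preserving map on `P ⊇ {u, v, w + h e₃}` extends to a linear isometry of `ℝ³`
(`exists_isometry_of_gram`, via `Basis.constr` and `LinearMap.isometryOfInner`); hence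
`S ∩ B(y, 13/10 a) = y + B '' N` exactly (`exact_cluster`). [folklore]
-/

noncomputable section

namespace Summit.AtomisticToContinuum.Crystallization.Theorems.ExactHcpLocal

open Literature.MathematicalPhysics.StatisticalMechanics

variable {a h : ℝ}

/-! ## Exactification file: `η`-congruence for every `η > 0` is exact congruence -/

section Exactify

open RealInnerProductSpace Literature.Geometry.DiscreteGeometry

/-- The punctured cluster is finite (its sites have indices in `{−1, 0, 1}³`). [folklore] -/
theorem finite_puncturedCluster (ha : 0 < a) (hh1 : 64 / 100 * a ^ 2 < h ^ 2)
    (hh2 : h ^ 2 < 69 / 100 * a ^ 2) :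
    {p : EuclideanSpace ℝ (Fin 3) | p ∈ hcpStacking a h ∧ p ≠ 0 ∧ ‖p‖ < 13 / 10 * a}.Finite := by
  have hbox : (Set.Icc (-1 : ℤ) 1 ×ˢ (Set.Icc (-1 : ℤ) 1 ×ˢ Set.Icc (-1 : ℤ) 1)).Finite :=
    (Set.finite_Icc _ _).prod ((Set.finite_Icc _ _).prod (Set.finite_Icc _ _))
  refine (hbox.image fun q : ℤ × ℤ × ℤ => barlowPos a h alternatingHagg q.1 q.2.1 q.2.2).subset ?_
  rintro p ⟨⟨k, i, j, rfl⟩, -, hn⟩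
  have hidx := (norm_site_lt_iff ha hh1 hh2 k i j).1 hn
  refine ⟨(k, i, j), ?_, rfl⟩
  simp only [Set.mem_prod, Set.mem_Icc]
  omega

/-- **Pigeonhole on the bijections.** If for every `η > 0` some bijection `e : T ≃ P` onto a
finite set and some linear isometry realise an `η`-congruence, then ONE bijection does so for
every `η > 0` (finitely many bijections; the property is monotone in `η`). [folklore] -/
theorem exists_equiv_forall_eta {T P : Set (EuclideanSpace ℝ (Fin 3))} [Finite P]
    {y : EuclideanSpace ℝ (Fin 3)}
    (hloc : ∀ η : ℝ, 0 < η → ∃ A : EuclideanSpace ℝ (Fin 3) →ₗᵢ[ℝ] EuclideanSpace ℝ (Fin 3),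
      ∃ e : T ≃ P, ∀ t : T, dist ((t : EuclideanSpace ℝ (Fin 3)) - y) (A (e t : P)) ≤ η) :
    ∃ e : T ≃ P, ∀ η : ℝ, 0 < η → ∃ A : EuclideanSpace ℝ (Fin 3) →ₗᵢ[ℝ] EuclideanSpace ℝ (Fin 3),
      ∀ t : T, dist ((t : EuclideanSpace ℝ (Fin 3)) - y) (A (e t : P)) ≤ η := by
  obtain ⟨-, e₁, -⟩ := hloc 1 one_pos
  haveI : Finite T := Finite.of_equiv _ e₁.symm
  haveI : Nonempty (T ≃ P) := ⟨e₁⟩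
  by_contra hne
  push Not at hne
  choose ηf hηf hbad using hne
  obtain ⟨e₀, he₀⟩ := Finite.exists_min ηf
  obtain ⟨A, e, hAe⟩ := hloc (ηf e₀) (hηf e₀)
  obtain ⟨t, ht⟩ := hbad e A
  have := hAe t
  linarith [he₀ e]

/-- **Gram equality.** Under `η`-congruence for every `η > 0` by one bijection `e`, the
recentred shell and its labels have the same Gram matrix:
`⟪t − y, t' − y⟫ = ⟪e t, e t'⟫` (the error is `≤ 2 r η` for every `η`). [folklore] -/
theorem inner_eq_of_forall_eta {T P : Set (EuclideanSpace ℝ (Fin 3))} {y : EuclideanSpace ℝ (Fin 3)}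
    {r : ℝ} (hr : 0 < r) (hT : ∀ t : T, ‖(t : EuclideanSpace ℝ (Fin 3)) - y‖ ≤ r)
    (hP : ∀ p : P, ‖(p : EuclideanSpace ℝ (Fin 3))‖ ≤ r) (e : T ≃ P)
    (hη : ∀ η : ℝ, 0 < η → ∃ A : EuclideanSpace ℝ (Fin 3) →ₗᵢ[ℝ] EuclideanSpace ℝ (Fin 3),
      ∀ t : T, dist ((t : EuclideanSpace ℝ (Fin 3)) - y) (A (e t : P)) ≤ η) (t t' : T) :
    ⟪(t : EuclideanSpace ℝ (Fin 3)) - y, (t' : EuclideanSpace ℝ (Fin 3)) - y⟫ =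
      ⟪((e t : P) : EuclideanSpace ℝ (Fin 3)), ((e t' : P) : EuclideanSpace ℝ (Fin 3))⟫ := by
  apply eq_of_forall_dist_le
  intro ε hε
  obtain ⟨A, hA⟩ := hη (ε / (2 * r)) (by positivity)
  have key : ∀ α α' β β' : EuclideanSpace ℝ (Fin 3),
      |⟪α, α'⟫ - ⟪β, β'⟫| ≤ ‖α - β‖ * ‖α'‖ + ‖β‖ * ‖α' - β'‖ := by
    intro α α' β β'
    have hsplit : ⟪α, α'⟫ - ⟪β, β'⟫ = ⟪α - β, α'⟫ + ⟪β, α' - β'⟫ := by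
      rw [inner_sub_left, inner_sub_right]; ring
    rw [hsplit]
    exact (abs_add_le _ _).trans
      (add_le_add (abs_real_inner_le_norm _ _) (abs_real_inner_le_norm _ _))
  rw [Real.dist_eq, ← A.inner_map_map ((e t : P) : EuclideanSpace ℝ (Fin 3))
    ((e t' : P) : EuclideanSpace ℝ (Fin 3))]
  refine (key _ _ _ _).trans ?_
  have h1 : ‖(t : EuclideanSpace ℝ (Fin 3)) - y - A ((e t : P) : EuclideanSpace ℝ (Fin 3))‖ ≤
      ε / (2 * r) := by
    rw [← dist_eq_norm]; exact hA t
  have h2 : ‖(t' : EuclideanSpace ℝ (Fin 3)) - y - A ((e t' : P) : EuclideanSpace ℝ (Fin 3))‖ ≤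
      ε / (2 * r) := by
    rw [← dist_eq_norm]; exact hA t'
  have h3 : ‖(t' : EuclideanSpace ℝ (Fin 3)) - y‖ ≤ r := hT t'
  have h4 : ‖A ((e t : P) : EuclideanSpace ℝ (Fin 3))‖ ≤ r := by rw [A.norm_map]; exact hP _
  calc ‖(t : EuclideanSpace ℝ (Fin 3)) - y - A ((e t : P) : EuclideanSpace ℝ (Fin 3))‖ *
          ‖(t' : EuclideanSpace ℝ (Fin 3)) - y‖ +
        ‖A ((e t : P) : EuclideanSpace ℝ (Fin 3))‖ *
          ‖(t' : EuclideanSpace ℝ (Fin 3)) - y - A ((e t' : P) : EuclideanSpace ℝ (Fin 3))‖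
        ≤ ε / (2 * r) * r + r * (ε / (2 * r)) :=
          add_le_add (mul_le_mul h1 h3 (norm_nonneg _) (by positivity))
            (mul_le_mul h4 h2 (norm_nonneg _) hr.le)
    _ = ε := by field_simp; ring

/-- **A linear isometry from Gram data on the frame.** Let `φ` be a map on the punctured
cluster `P` preserving all inner products (`⟪φ p, φ q⟫ = ⟪p, q⟫` for `p, q ∈ P`).  Then there is
a linear isometry equivalence `B` of `ℝ³` with `B p = φ p` for every `p ∈ P`: define `B` on the
frame basis `u, v, w + h e₃ ⊆ P` by `φ` (`Basis.constr`), check inner products by bilinearity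
(`LinearMap.isometryOfInner`), and `‖B p − φ p‖² = 0` on `P`. [folklore] -/
theorem exists_isometry_of_gram (ha : 0 < a) (hh : 0 < h) (hh1 : 64 / 100 * a ^ 2 < h ^ 2)
    (hh2 : h ^ 2 < 69 / 100 * a ^ 2) (φ : EuclideanSpace ℝ (Fin 3) → EuclideanSpace ℝ (Fin 3))
    (hφ : ∀ p ∈ {p : EuclideanSpace ℝ (Fin 3) | p ∈ hcpStacking a h ∧ p ≠ 0 ∧ ‖p‖ < 13 / 10 * a},
      ∀ q ∈ {p : EuclideanSpace ℝ (Fin 3) | p ∈ hcpStacking a h ∧ p ≠ 0 ∧ ‖p‖ < 13 / 10 * a},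
        ⟪φ p, φ q⟫ = ⟪p, q⟫) :
    ∃ B : EuclideanSpace ℝ (Fin 3) ≃ₗᵢ[ℝ] EuclideanSpace ℝ (Fin 3),
      ∀ p ∈ {p : EuclideanSpace ℝ (Fin 3) | p ∈ hcpStacking a h ∧ p ≠ 0 ∧ ‖p‖ < 13 / 10 * a},
        B p = φ p := by
  set P := {p : EuclideanSpace ℝ (Fin 3) | p ∈ hcpStacking a h ∧ p ≠ 0 ∧ ‖p‖ < 13 / 10 * a} with hPdef
  -- the frame lies in `P`
  have site_ne_zero : ∀ k i j : ℤ, ¬ (k = 0 ∧ i = 0 ∧ j = 0) → barlowPos a h alternatingHagg k i j ≠ 0 := by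
    intro k i j hne h0
    rw [← barlowPos_alternating_zero a h] at h0
    have := site_inj ha.ne' hh.ne' h0
    exact hne this
  have memP : ∀ k i j : ℤ, ((k = 0 ∧ -1 ≤ i ∧ i ≤ 1 ∧ -1 ≤ j ∧ j ≤ 1 ∧ -1 ≤ i + j ∧ i + j ≤ 1) ∨
      ((k = 1 ∨ k = -1) ∧ -1 ≤ i ∧ i ≤ 0 ∧ -1 ≤ j ∧ j ≤ 0 ∧ -1 ≤ i + j)) →
      ¬ (k = 0 ∧ i = 0 ∧ j = 0) → barlowPos a h alternatingHagg k i j ∈ P := fun k i j hL hne =>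
    ⟨barlowPos_mem _ _ _, site_ne_zero k i j hne, (norm_site_lt_iff ha hh1 hh2 k i j).2 hL⟩
  set f : Fin 3 → EuclideanSpace ℝ (Fin 3) := ![barlowPos a h alternatingHagg 0 1 0,
    barlowPos a h alternatingHagg 0 0 1, barlowPos a h alternatingHagg 1 0 0] with hf
  have hfP : ∀ i, f i ∈ P := by
    intro i
    fin_cases i
    · exact memP 0 1 0 (by omega) (by omega)
    · exact memP 0 0 1 (by omega) (by omega)
    · exact memP 1 0 0 (by omega) (by omega)
  let b : Module.Basis (Fin 3) ℝ (EuclideanSpace ℝ (Fin 3)) :=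
    basisOfLinearIndependentOfCardEqFinrank (linearIndependent_frame ha.ne' hh.ne') (by simp)
  have hb : ⇑b = f := coe_basisOfLinearIndependentOfCardEqFinrank _ _
  set L : EuclideanSpace ℝ (Fin 3) →ₗ[ℝ] EuclideanSpace ℝ (Fin 3) := b.constr ℝ fun i => φ (f i) with hL
  have hLb : ∀ i, L (b i) = φ (f i) := fun i => by rw [hL, Module.Basis.constr_basis]
  -- `⟪L x, φ q⟫ = ⟪x, q⟫` for `q ∈ P`
  have hLq : ∀ x, ∀ q ∈ P, ⟪L x, φ q⟫ = ⟪x, q⟫ := by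
    intro x q hq
    conv_lhs => rw [← b.sum_repr x]
    conv_rhs => rw [← b.sum_repr x]
    simp only [map_sum, map_smul, sum_inner, inner_smul_left, hLb]
    refine Finset.sum_congr rfl fun i _ => ?_
    rw [hφ _ (hfP i) _ hq, hb]
  -- `L` preserves inner products
  have hLL : ∀ x x', ⟪L x, L x'⟫ = ⟪x, x'⟫ := by
    intro x x'
    conv_lhs => rw [← b.sum_repr x']
    conv_rhs => rw [← b.sum_repr x']
    simp only [map_sum, map_smul, inner_sum, inner_smul_right, hLb]
    refine Finset.sum_congr rfl fun i _ => ?_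
    rw [hLq x _ (hfP i), hb]
  set B₀ := L.isometryOfInner hLL with hB₀
  refine ⟨B₀.toLinearIsometryEquiv rfl, fun p hp => ?_⟩
  rw [LinearIsometry.toLinearIsometryEquiv_apply, hB₀, LinearMap.coe_isometryOfInner]
  -- `‖L p - φ p‖² = 0`
  have h0 : ⟪L p - φ p, L p - φ p⟫ = 0 := by
    rw [inner_sub_left, inner_sub_right, inner_sub_right, hLL, hLq p p hp, real_inner_comm (L p) (φ p),
      hLq p p hp, hφ p hp p hp]
    ring
  rw [real_inner_self_eq_norm_sq] at h0
  have : ‖L p - φ p‖ = 0 := by nlinarith [norm_nonneg (L p - φ p)]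
  exact sub_eq_zero.1 (norm_eq_zero.1 this)

/-- **Exactification.** If the punctured `13/10 a`-neighbourhood `T` of `y` in `S` is
`η`-congruent (linear isometry + bijection onto the punctured cluster `P`) for every `η > 0`,
then the neighbourhood of `y` in `S` is EXACTLY a linear-isometric copy of the cluster:
`S ∩ B(y, 13/10 a) = y + B '' N`. [folklore] -/
theorem exact_cluster (ha : 0 < a) (hh : 0 < h) (hh1 : 64 / 100 * a ^ 2 < h ^ 2)
    (hh2 : h ^ 2 < 69 / 100 * a ^ 2) {S : Set (EuclideanSpace ℝ (Fin 3))}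
    {y : EuclideanSpace ℝ (Fin 3)} (hy : y ∈ S)
    (hloc : ∀ η : ℝ, 0 < η → ∃ A : EuclideanSpace ℝ (Fin 3) →ₗᵢ[ℝ] EuclideanSpace ℝ (Fin 3),
      ∃ e : ↥{z : EuclideanSpace ℝ (Fin 3) | z ∈ S ∧ z ≠ y ∧ dist z y < 13 / 10 * a} ≃
        ↥{p : EuclideanSpace ℝ (Fin 3) | p ∈ hcpStacking a h ∧ p ≠ 0 ∧ ‖p‖ < 13 / 10 * a},
      ∀ t : ↥{z : EuclideanSpace ℝ (Fin 3) | z ∈ S ∧ z ≠ y ∧ dist z y < 13 / 10 * a},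
        dist ((t : EuclideanSpace ℝ (Fin 3)) - y)
          (A ((e t : ↥{p : EuclideanSpace ℝ (Fin 3) | p ∈ hcpStacking a h ∧ p ≠ 0 ∧ ‖p‖ < 13 / 10 * a}) :
            EuclideanSpace ℝ (Fin 3))) ≤ η) :
    ∃ B : EuclideanSpace ℝ (Fin 3) ≃ₗᵢ[ℝ] EuclideanSpace ℝ (Fin 3),
      S ∩ Metric.ball y (13 / 10 * a) = (fun n => y + B n) ''
        {p : EuclideanSpace ℝ (Fin 3) | p ∈ hcpStacking a h ∧ ‖p‖ < 13 / 10 * a} := by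
  set T := {z : EuclideanSpace ℝ (Fin 3) | z ∈ S ∧ z ≠ y ∧ dist z y < 13 / 10 * a} with hTdef
  set P := {p : EuclideanSpace ℝ (Fin 3) | p ∈ hcpStacking a h ∧ p ≠ 0 ∧ ‖p‖ < 13 / 10 * a} with hPdef
  set N := {p : EuclideanSpace ℝ (Fin 3) | p ∈ hcpStacking a h ∧ ‖p‖ < 13 / 10 * a} with hNdef
  haveI : Finite P := (finite_puncturedCluster ha hh1 hh2).to_subtype
  obtain ⟨e, he⟩ := exists_equiv_forall_eta hloc
  have hr : (0 : ℝ) < 13 / 10 * a := by positivity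
  have gram := inner_eq_of_forall_eta hr (T := T) (P := P) (y := y)
    (fun t => by rw [← dist_eq_norm]; exact le_of_lt t.2.2.2) (fun p => le_of_lt p.2.2.2) e he
  classical
  -- the Gram-preserving map on `P`
  set φ : EuclideanSpace ℝ (Fin 3) → EuclideanSpace ℝ (Fin 3) := fun p =>
    if hp : p ∈ P then ((e.symm ⟨p, hp⟩ : T) : EuclideanSpace ℝ (Fin 3)) - y else 0 with hφdef
  have hφ : ∀ p (hp : p ∈ P), φ p = ((e.symm ⟨p, hp⟩ : T) : EuclideanSpace ℝ (Fin 3)) - y := by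
    intro p hp; rw [hφdef]; simp only [dif_pos hp]
  have hφgram : ∀ p ∈ P, ∀ q ∈ P, ⟪φ p, φ q⟫ = ⟪p, q⟫ := by
    intro p hp q hq
    rw [hφ p hp, hφ q hq, gram]
    simp
  obtain ⟨B, hB⟩ := exists_isometry_of_gram ha hh hh1 hh2 φ hφgram
  refine ⟨B, Set.Subset.antisymm ?_ ?_⟩
  · rintro x ⟨hxS, hxb⟩
    rw [Metric.mem_ball] at hxb
    by_cases hxy : x = y
    · refine ⟨0, ⟨⟨0, 0, 0, (barlowPos_alternating_zero a h).symm⟩, by simp; positivity⟩, ?_⟩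
      simp [hxy]
    · have hxT : x ∈ T := ⟨hxS, hxy, hxb⟩
      set q := e ⟨x, hxT⟩ with hq
      refine ⟨(q : EuclideanSpace ℝ (Fin 3)), ⟨q.2.1, q.2.2.2⟩, ?_⟩
      show y + B q = x
      rw [hB _ q.2, hφ _ q.2]
      have : e.symm ⟨(q : EuclideanSpace ℝ (Fin 3)), q.2⟩ = ⟨x, hxT⟩ := by
        rw [Subtype.coe_eta, hq, e.symm_apply_apply]
      rw [this]; abel
  · rintro x ⟨n, hn, rfl⟩
    by_cases hn0 : n = 0
    · subst hn0
      simp only [map_zero, add_zero]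
      exact ⟨hy, Metric.mem_ball_self hr⟩
    · have hnP : n ∈ P := ⟨hn.1, hn0, hn.2⟩
      have e1 : y + B n = ((e.symm ⟨n, hnP⟩ : T) : EuclideanSpace ℝ (Fin 3)) := by
        rw [hB n hnP, hφ n hnP]; abel
      show y + B n ∈ S ∩ Metric.ball y (13 / 10 * a)
      rw [e1]
      set t := e.symm ⟨n, hnP⟩
      exact ⟨t.2.1, by rw [Metric.mem_ball]; exact t.2.2.2⟩

end Exactify

end Summit.AtomisticToContinuum.Crystallization.Theorems.ExactHcpLocal

end
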